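import Literature.RingTheory.KrullDimension.FibreInequality
import Literature.RingTheory.KrullDimension.AffineDimension
import Mathlib.RingTheory.MvPolynomial.Basic
import Mathlib.RingTheory.Ideal.Quotient.Operations
import Mathlib.LinearAlgebra.Matrix.NonsingularInverse
import Mathlib.Data.Matrix.Mul
import Mathlib.Data.Fin.VecNotation
import Mathlib.Tactic.FinCases
import Mathlib.Tactic.LinearCombination
import Mathlib.Tactic.DeriveFintype
import HarnessLib

/-!
# Strong lines cover a `(2,3)` complete intersection in `ℙ⁸`: the algebra of the universal family

Hirschowitz–Iyer, *Hilbert schemes of fat r-planes and the triviality of Chow groups of complete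
intersections* [HirschowitzIyer2010], §6 Prop. 6.1 ("spannedness": if `ρ + r ≥ n - s` then every pair
`Y ⊂ Y'` of type `(d₁, …, d_s)` in `ℙⁿ` is covered by strong `r`-planes), in the case
`(n, r, s, d) = (8, 1, 2, (2, 3))` needed by the tree's named fact
`HirschowitzIyer2010_QCH1_quadricCubic_P8` (`Motives/HirschowitzIyerQuadricCubic`): **through every point
`x` of `Y = V₊(Q, C) ⊂ ℙ⁸` there is a STRONG LINE**, i.e. a line `ℓ ∋ x` and a `2`-plane `Π ⊇ ℓ`
with `Q|_Π = 0` and `C|_Π ∈ k · m³` for the linear form `m` of `ℓ` in `Π` (a `3`-fat line in `Y`, HI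
Prop. 2.3; `Π ∩ Y = ℓ` set-theoretically or `Π ⊆ Y`). HI prove this through the restricted flag-Hilbert
scheme `𝒟' → ℋ₂'` of (fat plane ⊂ complete intersection): it is projective, hence onto as soon as it
is dominant, and dominance is smoothness at ONE point (Prop. 4.1 (i): `codim 𝒟' = c`; Lemma 4.5 (iv)
and Prop. 4.6 via the maximal-rank Lemma 5.2). This file carries out the ALGEBRA of that argument in
coordinates, replacing Hilbert schemes by an explicit affine parametrisation and the deformation
theory by an explicit rigid example:

* Coordinates (`ZVar`, `NVar`, `RZ = k[𝔸⁸¹⁶]`, `RN = k[N]`, `N = 𝔸⁸¹⁸`): a point of `N` is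
  `(B, T, x')` — a bilinear form `B`, a trilinear form `T` on `k⁹` (so `Q = Q_B`, `C = C_T`) and the
  point `x = (1, x')`; a point of `𝔸⁸¹⁶` is a normalised frame `x = (1, x')`, `a = (0, 1, a')`,
  `y = (0, 0, 1, y')` of a flag `x ∈ ℓ = span(x, a) ⊆ Π = span(x, a, y)` together with forms
  `(B', T')` adapted to the STANDARD flag (`Bp`, `Tp`: `Q_{B'}` vanishes on `span(e₀, e₁, e₂)` and
  `C_{T'}(s e₀ + t e₁ + r e₂) ∈ k · r³` — six, resp. nine, linear conditions, solved for dependent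
  entries).
* **The universal family** `phiStar : RN →ₐ RZ` (`Φ : 𝔸⁸¹⁶ → N`,
  `(frame, B', T') ↦ (x', B' ∘ g⁻¹, T' ∘ g⁻¹)` with `g = [x | a | y | e₃ | ⋯ | e₈]`, `ginv` its explicit
  inverse, `g_mul_ginv`): by construction `ℓ` is a strong line of `(Q_B, C_T)` through `x` with witness
  plane `Π` — HI's tautological flag `ℒ ⊂ ℒ'` of the proof of Prop. 4.1. `phiStar_QBx`, `phiStar_CTx`:
  the image lies in the incidence `𝕋 = {Q_B(x) = C_T(x) = 0}` (`incidenceIdeal = (QBx, CTx)`).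
* **The rigid example** (`t0`, `z0`; `Q₀ = x₀x₃ + x₁x₄ + x₂x₅`,
  `C₀ = x₀²x₆ + x₀x₁x₇ + x₀x₂x₈ + x₁²x₅ + x₁x₂x₈ + x₂³ + x₁x₈²`, the flag `e₀ ∈ span(e₀,e₁) ⊆
  span(e₀,e₁,e₂)`, `Π₀ ∩ V(C₀) = 3ℓ₀`): `X_sub_C_z0_mem` — **every ideal of `RZ` containing
  `Φ*(𝔪_{t₀})` contains `𝔪_{z₀}`**, i.e. `z₀` is an isolated, reduced point of the fibre `Φ⁻¹(t₀)`.
  Proof: modulo such an ideal the `13` flag coordinates satisfy `13` polynomial equations (`eB11`, …,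
  `eT122`, read off from `B' = gᵀ (Φ*B) g`, `T' = (Φ*T) ∘ g`, `Bmat_eq`, `Tp_eq`) whose Jacobian is
  triangular with non-zero diagonal; they are solved outright (`hA_all`), after which `g ≡ 1` and the
  form coordinates are those of `(B₀, T₀)`. This is the tree's substitute for HI's Lemma 4.5 (iv) /
  Lemma 5.2 (smoothness of `𝒟' → ℋ₂'` at one point) at the boundary case `ρ' = ρ + r - n + s = 0`.
* **Dominance** `ker_phiStar_eq`: **`ker Φ* = (Q_B(x), C_T(x))`** over an algebraically closed field
  of characteristic zero — the closure of `Φ(𝔸⁸¹⁶)` is the whole incidence `𝕋`. Proof: `𝕋` is a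
  polynomial ring in `816` variables modulo nothing (`quotIncidenceEquiv`: eliminate `B₀₀`, `T₀₀₀`),
  so `(QBx, CTx)` is a prime of dimension `816`; the closure of the image `V(ker Φ*) ⊆ 𝕋` has dimension
  `≥ 816` by the fibre-dimension inequality at the isolated point `z₀`
  (`Literature.RingTheory.KrullDimension.ringKrullDim_le_ringKrullDim_quotient_add`, Matsumura 15.1),
  hence equals `𝕋` (`ringKrullDim_quotient_add_one_le`). `eval_eq_zero_of_mem_ker`: every `k`-point
  `(B, T, x')` with `Q_B(x) = C_T(x) = 0` lies in that closure.

The geometric half — `Φ` extends to `𝔸⁸¹⁶ → N × ℙ⁸⁰` (Plücker coordinates of `ℓ`), whose image is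
closed over `N` by properness of `ℙ⁸⁰` and consists of strong lines (strongness is a closed condition),
so that EVERY point of `𝕋` carries a strong line — is the sequel.

## What is NOT here

* Hilbert schemes, normal bundles and the maximal-rank lemma of HI §§3–5 (replaced by the explicit
  example); the general `(n, r, s, d)`; positive characteristic (`3` must be invertible, `hA0`).

## References

* A. Hirschowitz, J. N. N. Iyer, *Hilbert schemes of fat r-planes and the triviality of Chow groups
  of complete intersections*, in: Vector bundles and complex geometry, Contemp. Math. 522 (2010),
  53–70, doi:10.1090/conm/522/10291, arXiv:0903.5018: §2 Prop. 2.3, §4 Prop. 4.1, Lemma 4.5,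
  Prop. 4.6, §5 Lemma 5.2, §6 Prop. 6.1–6.2. [HirschowitzIyer2010]
* H. Matsumura, *Commutative Ring Theory* (1986), Thm. 15.1 (fibre dimension). [Matsumura1987]
-/

noncomputable section

open MvPolynomial Matrix

namespace Literature.AlgebraicGeometry.Motives

namespace StrongLineCover

/-! ### Index types -/

/-- The 6 entries of a bilinear form on `k⁹` forced (up to sign) by `Q_B|_{span(e₀,e₁,e₂)} = 0`:
`B₀₀ = B₁₁ = B₂₂ = 0`, `B₁₀ = -B₀₁`, `B₂₀ = -B₀₂`, `B₂₁ = -B₁₂`.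
[folklore] -/
def depB : Finset (Fin 9 × Fin 9) := {(0,0), (1,1), (2,2), (1,0), (2,0), (2,1)}

/-- The 9 sorted index triples inside `{0,1,2}` other than `(2,2,2)`: the dependent entries of a
trilinear form `T` with `C_T|_{span(e₀,e₁,e₂)} ∈ k · x₂³` and vanishing to order `3` along
`span(e₀,e₁)`.
[folklore] -/
def depT : Finset (Fin 9 × Fin 9 × Fin 9) :=
  {(0,0,0), (0,0,1), (0,0,2), (0,1,1), (0,1,2), (0,2,2), (1,1,1), (1,1,2), (1,2,2)}

/-- Free entries of `B'`. [folklore] -/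
abbrev FB := {ij : Fin 9 × Fin 9 // ij ∉ depB}
/-- Free entries of `T'`. [folklore] -/
abbrev FT := {p : Fin 9 × Fin 9 × Fin 9 // p ∉ depT}

/-- Coordinates on the source `𝔸⁸¹⁶` of the universal family: the frame `(x', a', y')` of the flag
`x ∈ ℓ = span(x, a) ⊆ Π = span(x, a, y)` (`x = (1, x')`, `a = (0, 1, a')`, `y = (0, 0, 1, y')`) and
the free entries of the forms `B'`, `T'` adapted to the standard flag.
[folklore] -/
inductive ZVar
  | x (i : Fin 8)
  | a (i : Fin 7)
  | y (i : Fin 6)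
  | b (ij : FB)
  | t (p : FT)
  deriving DecidableEq, Fintype

/-- Coordinates on the target `N = 𝔸⁸¹⁸`: the point `x = (1, x')`, a bilinear form `B` and a
trilinear form `T` on `k⁹`.
[folklore] -/
inductive NVar
  | x (i : Fin 8)
  | b (ij : Fin 9 × Fin 9)
  | t (p : Fin 9 × Fin 9 × Fin 9)
  deriving DecidableEq, Fintype

variable (k : Type*) [CommRing k]

/-- `R_Z = k[𝔸⁸¹⁶]`. [folklore] -/
abbrev RZ := MvPolynomial ZVar k
/-- `R_N = k[𝔸⁸¹⁸]`. [folklore] -/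
abbrev RN := MvPolynomial NVar k

variable {k}

/-! ### The frame and the unipotent matrix `g = [x | a | y | e₃ | ⋯ | e₈]` -/

/-- `x = (1, x'₁, …, x'₈)`. [folklore] -/
def xv : Fin 9 → RZ k :=
  ![1, X (.x 0), X (.x 1), X (.x 2), X (.x 3), X (.x 4), X (.x 5), X (.x 6), X (.x 7)]

/-- `a = (0, 1, a₂, …, a₈)`. [folklore] -/
def av : Fin 9 → RZ k :=
  ![0, 1, X (.a 0), X (.a 1), X (.a 2), X (.a 3), X (.a 4), X (.a 5), X (.a 6)]

/-- `y = (0, 0, 1, y₃, …, y₈)`. [folklore] -/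
def yv : Fin 9 → RZ k :=
  ![0, 0, 1, X (.y 0), X (.y 1), X (.y 2), X (.y 3), X (.y 4), X (.y 5)]

/-- The frame: `f₀ = x`, `f₁ = a`, `f₂ = y`, `f_c = e_c` for `c ≥ 3`. [folklore] -/
def frame (c : Fin 9) : Fin 9 → RZ k :=
  if c = 0 then xv else if c = 1 then av else if c = 2 then yv else Pi.single c 1

/-- `g = [x | a | y | e₃ | ⋯ | e₈]` (columns), unipotent lower triangular. [folklore] -/
def g : Matrix (Fin 9) (Fin 9) (RZ k) := Matrix.of fun r c => frame c r

/-- The explicit inverse of `g`. [folklore] -/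
def ginv : Matrix (Fin 9) (Fin 9) (RZ k) := Matrix.of fun r c =>
  if c = 0 then
    (if r = 0 then 1 else if r = 1 then - xv 1 else if r = 2 then - xv 2 + xv 1 * av 2
      else - xv r + xv 1 * av r + xv 2 * yv r - xv 1 * av 2 * yv r)
  else if c = 1 then
    (if r = 0 then 0 else if r = 1 then 1 else if r = 2 then - av 2 else - av r + av 2 * yv r)
  else if c = 2 then
    (if r = 0 then 0 else if r = 1 then 0 else if r = 2 then 1 else - yv r)
  else if r = c then 1 else 0

set_option maxHeartbeats 800000 in
/-- Column `0` of `g · g⁻¹ = 1`. [folklore] -/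
private theorem g_mul_ginv_col0 (r : Fin 9) :
    (g (k := k) * ginv (k := k)) r (0 : Fin 9) = (1 : Matrix (Fin 9) (Fin 9) (RZ k)) r (0 : Fin 9) := by
  rw [Matrix.mul_apply]
  fin_cases r <;>
    simp (config := {decide := true}) [g, ginv, frame, xv, av, yv, Fin.sum_univ_succ, Matrix.one_apply] <;> ring

set_option maxHeartbeats 800000 in
/-- Column `1` of `g · g⁻¹ = 1`. [folklore] -/
private theorem g_mul_ginv_col1 (r : Fin 9) :
    (g (k := k) * ginv (k := k)) r (1 : Fin 9) = (1 : Matrix (Fin 9) (Fin 9) (RZ k)) r (1 : Fin 9) := by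
  rw [Matrix.mul_apply]
  fin_cases r <;>
    simp (config := {decide := true}) [g, ginv, frame, xv, av, yv, Fin.sum_univ_succ, Matrix.one_apply] <;> ring

set_option maxHeartbeats 800000 in
/-- Column `2` of `g · g⁻¹ = 1`. [folklore] -/
private theorem g_mul_ginv_col2 (r : Fin 9) :
    (g (k := k) * ginv (k := k)) r (2 : Fin 9) = (1 : Matrix (Fin 9) (Fin 9) (RZ k)) r (2 : Fin 9) := by
  rw [Matrix.mul_apply]
  fin_cases r <;>
    simp (config := {decide := true}) [g, ginv, frame, xv, av, yv, Fin.sum_univ_succ, Matrix.one_apply]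

set_option maxHeartbeats 800000 in
/-- Column `3` of `g · g⁻¹ = 1`. [folklore] -/
private theorem g_mul_ginv_col3 (r : Fin 9) :
    (g (k := k) * ginv (k := k)) r (3 : Fin 9) = (1 : Matrix (Fin 9) (Fin 9) (RZ k)) r (3 : Fin 9) := by
  rw [Matrix.mul_apply]
  fin_cases r <;>
    simp (config := {decide := true}) [g, ginv, frame, xv, av, yv, Matrix.one_apply]

set_option maxHeartbeats 800000 in
/-- Column `4` of `g · g⁻¹ = 1`. [folklore] -/
private theorem g_mul_ginv_col4 (r : Fin 9) :
    (g (k := k) * ginv (k := k)) r (4 : Fin 9) = (1 : Matrix (Fin 9) (Fin 9) (RZ k)) r (4 : Fin 9) := by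
  rw [Matrix.mul_apply]
  fin_cases r <;>
    simp (config := {decide := true}) [g, ginv, frame, xv, av, yv, Matrix.one_apply]

set_option maxHeartbeats 800000 in
/-- Column `5` of `g · g⁻¹ = 1`. [folklore] -/
private theorem g_mul_ginv_col5 (r : Fin 9) :
    (g (k := k) * ginv (k := k)) r (5 : Fin 9) = (1 : Matrix (Fin 9) (Fin 9) (RZ k)) r (5 : Fin 9) := by
  rw [Matrix.mul_apply]
  fin_cases r <;>
    simp (config := {decide := true}) [g, ginv, frame, xv, av, yv, Matrix.one_apply]

set_option maxHeartbeats 800000 in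
/-- Column `6` of `g · g⁻¹ = 1`. [folklore] -/
private theorem g_mul_ginv_col6 (r : Fin 9) :
    (g (k := k) * ginv (k := k)) r (6 : Fin 9) = (1 : Matrix (Fin 9) (Fin 9) (RZ k)) r (6 : Fin 9) := by
  rw [Matrix.mul_apply]
  fin_cases r <;>
    simp (config := {decide := true}) [g, ginv, frame, xv, av, yv, Matrix.one_apply]

set_option maxHeartbeats 800000 in
/-- Column `7` of `g · g⁻¹ = 1`. [folklore] -/
private theorem g_mul_ginv_col7 (r : Fin 9) :
    (g (k := k) * ginv (k := k)) r (7 : Fin 9) = (1 : Matrix (Fin 9) (Fin 9) (RZ k)) r (7 : Fin 9) := by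
  rw [Matrix.mul_apply]
  fin_cases r <;>
    simp (config := {decide := true}) [g, ginv, frame, xv, av, yv, Matrix.one_apply]

set_option maxHeartbeats 800000 in
/-- Column `8` of `g · g⁻¹ = 1`. [folklore] -/
private theorem g_mul_ginv_col8 (r : Fin 9) :
    (g (k := k) * ginv (k := k)) r (8 : Fin 9) = (1 : Matrix (Fin 9) (Fin 9) (RZ k)) r (8 : Fin 9) := by
  rw [Matrix.mul_apply]
  fin_cases r <;>
    simp (config := {decide := true}) [g, ginv, frame, xv, av, yv, Matrix.one_apply]

/-- `g · g⁻¹ = 1`. [folklore] -/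
theorem g_mul_ginv : g (k := k) * ginv = 1 := by
  refine Matrix.ext fun r c => ?_
  fin_cases c
  exacts [g_mul_ginv_col0 (k := k) r, g_mul_ginv_col1 (k := k) r, g_mul_ginv_col2 (k := k) r, g_mul_ginv_col3 (k := k) r,
    g_mul_ginv_col4 (k := k) r, g_mul_ginv_col5 (k := k) r, g_mul_ginv_col6 (k := k) r, g_mul_ginv_col7 (k := k) r, g_mul_ginv_col8 (k := k) r]

/-- `g⁻¹ · g = 1`. [folklore] -/
theorem ginv_mul_g : ginv (k := k) * g = 1 :=
  (mul_eq_one_comm (a := g (k := k)) (b := ginv)).mp g_mul_ginv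


/-- The columns of `g` are the frame vectors. [folklore] -/
theorem g_mulVec_single (c : Fin 9) : g (k := k) *ᵥ Pi.single c 1 = frame c := by
  ext r
  simp [g, Matrix.mulVec_single]

/-- `g⁻¹ x = e₀`. [folklore] -/
theorem ginv_mulVec_xv : ginv (k := k) *ᵥ xv = Pi.single 0 1 := by
  have h : xv (k := k) = g *ᵥ Pi.single 0 1 := by rw [g_mulVec_single]; simp [frame]
  rw [h, Matrix.mulVec_mulVec, ginv_mul_g, Matrix.one_mulVec]

/-- `g⁻¹ a = e₁`. [folklore] -/
theorem ginv_mulVec_av : ginv (k := k) *ᵥ av = Pi.single 1 1 := by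
  have h : av (k := k) = g *ᵥ Pi.single 1 1 := by rw [g_mulVec_single]; simp [frame]
  rw [h, Matrix.mulVec_mulVec, ginv_mul_g, Matrix.one_mulVec]

/-- `g⁻¹ y = e₂`. [folklore] -/
theorem ginv_mulVec_yv : ginv (k := k) *ᵥ yv = Pi.single 2 1 := by
  have h : yv (k := k) = g *ᵥ Pi.single 2 1 := by rw [g_mulVec_single]; simp [frame]
  rw [h, Matrix.mulVec_mulVec, ginv_mul_g, Matrix.one_mulVec]

/-! ### The forms `B'`, `T'` adapted to the standard flag -/

/-- A free `B'`-variable (the index is checked to be free by `decide`). [folklore] -/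
abbrev bX (ij : Fin 9 × Fin 9) (h : ij ∉ depB := by decide) : RZ k := X (.b ⟨ij, h⟩)

/-- A free `T'`-variable (the index is checked to be free by `decide`). [folklore] -/
abbrev tX (p : Fin 9 × Fin 9 × Fin 9) (h : p ∉ depT := by decide) : RZ k := X (.t ⟨p, h⟩)

/-- The bilinear form `B'` with `Q_{B'}|_{span(e₀,e₁,e₂)} = 0`: free entries are variables, the six
dependent ones are `B'₀₀ = B'₁₁ = B'₂₂ = 0`, `B'₁₀ = -B'₀₁`, `B'₂₀ = -B'₀₂`, `B'₂₁ = -B'₁₂`.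
[folklore] -/
def Bp (i j : Fin 9) : RZ k :=
  if h : (i, j) ∈ depB then
    (if (i, j) = (1, 0) then - bX (0, 1) else if (i, j) = (2, 0) then - bX (0, 2)
      else if (i, j) = (2, 1) then - bX (1, 2) else 0)
  else X (.b ⟨(i, j), h⟩)

/-- The values of the nine dependent entries of `T'`: minus the sum of the other entries in the
same symmetrisation class, so that every coefficient of `C_{T'}(s e₀ + t e₁ + r e₂)` except that of
`r³` vanishes.
[folklore] -/
def depTval (p : Fin 9 × Fin 9 × Fin 9) : RZ k :=
  if p = (0, 0, 1) then -(tX (0, 1, 0) + tX (1, 0, 0))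
  else if p = (0, 0, 2) then -(tX (0, 2, 0) + tX (2, 0, 0))
  else if p = (0, 1, 1) then -(tX (1, 0, 1) + tX (1, 1, 0))
  else if p = (0, 1, 2) then -(tX (0, 2, 1) + tX (1, 0, 2) + tX (1, 2, 0) + tX (2, 0, 1) + tX (2, 1, 0))
  else if p = (0, 2, 2) then -(tX (2, 0, 2) + tX (2, 2, 0))
  else if p = (1, 1, 2) then -(tX (1, 2, 1) + tX (2, 1, 1))
  else if p = (1, 2, 2) then -(tX (2, 1, 2) + tX (2, 2, 1))
  else 0

/-- The trilinear form `T'`. [folklore] -/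
def Tp (p : Fin 9 × Fin 9 × Fin 9) : RZ k :=
  if h : p ∈ depT then depTval p else X (.t ⟨p, h⟩)

/-- `B'` as a matrix. [folklore] -/
def Bmat : Matrix (Fin 9) (Fin 9) (RZ k) := Matrix.of Bp

/-- `B = B' ∘ g⁻¹`, i.e. `Q_B(v) = Q_{B'}(g⁻¹ v)`: the matrix `(g⁻¹)ᵀ B' g⁻¹`. [folklore] -/
def phiBmat : Matrix (Fin 9) (Fin 9) (RZ k) := ginvᵀ * Bmat * ginv

/-- `T = T' ∘ g⁻¹`: `T_{cde} = Σ_{ijk} T'_{ijk} (g⁻¹)_{ic} (g⁻¹)_{jd} (g⁻¹)_{ke}`. [folklore] -/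
def phiT (p : Fin 9 × Fin 9 × Fin 9) : RZ k :=
  ∑ q : Fin 9 × Fin 9 × Fin 9, Tp q * ginv q.1 p.1 * ginv q.2.1 p.2.1 * ginv q.2.2 p.2.2

/-- The values of the universal family on the coordinates of `N`. [folklore] -/
def phiVal : NVar → RZ k
  | .x i => X (.x i)
  | .b ij => phiBmat ij.1 ij.2
  | .t p => phiT p

variable (k) in
/-- **The universal strong-line family at the level of coordinate rings**, `Φ* : k[N] → k[𝔸⁸¹⁶]`:
`(x', a', y', B', T') ↦ (x', B' ∘ g⁻¹, T' ∘ g⁻¹)`.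
[cite: HirschowitzIyer2010, §4 Prop. 4.1 and §6 Prop. 6.2 (proof)] -/
def phiStar : RN k →ₐ[k] RZ k := MvPolynomial.aeval phiVal

/-- `Φ*` on a coordinate of `N`. [folklore] -/
@[simp] theorem phiStar_X (n : NVar) : phiStar k (X n) = phiVal n := by
  simp [phiStar]

/-- `x = (1, x')` on `N`. [folklore] -/
def xN : Fin 9 → RN k :=
  ![1, X (.x 0), X (.x 1), X (.x 2), X (.x 3), X (.x 4), X (.x 5), X (.x 6), X (.x 7)]

/-- `Φ*` maps the point `x = (1, x')` of `N` to the frame vector `x`. [folklore] -/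
theorem phiStar_xN (i : Fin 9) : phiStar k (xN i) = xv i := by
  fin_cases i <;> simp [xN, xv, phiVal]

/-- `Q_B(x) = Σ B_{ij} x_i x_j ∈ k[N]`. [folklore] -/
def QBx : RN k := ∑ i : Fin 9, ∑ j : Fin 9, X (.b (i, j)) * xN i * xN j

/-- `C_T(x) = Σ T_{cde} x_c x_d x_e ∈ k[N]`. [folklore] -/
def CTx : RN k := ∑ p : Fin 9 × Fin 9 × Fin 9, X (.t p) * xN p.1 * xN p.2.1 * xN p.2.2

/-- Quadratic forms as `v ⬝ (M v)`. [folklore] -/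
theorem sum_sum_mul_eq_dotProduct_mulVec {R : Type*} [CommRing R] {n : ℕ} (M : Matrix (Fin n) (Fin n) R)
    (v : Fin n → R) : ∑ i, ∑ j, M i j * v i * v j = v ⬝ᵥ (M *ᵥ v) := by
  simp only [dotProduct, Matrix.mulVec, Finset.mul_sum]
  refine Finset.sum_congr rfl fun i _ => Finset.sum_congr rfl fun j _ => ?_
  ring

/-- `(Σ f)(Σ g)(Σ h) = Σ_{(c,d,e)} f_c g_d h_e`. [folklore] -/
theorem sum_mul_sum_mul_sum_eq_sum_prod {R : Type*} [CommRing R] {n : ℕ} (f g h : Fin n → R) :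
    (∑ c, f c) * (∑ d, g d) * (∑ e, h e) = ∑ p : Fin n × Fin n × Fin n, f p.1 * g p.2.1 * h p.2.2 := by
  rw [Fintype.sum_prod_type]
  simp_rw [Fintype.sum_prod_type]
  rw [Finset.sum_mul_sum, Finset.sum_mul]
  refine Finset.sum_congr rfl fun c _ => ?_
  rw [Finset.sum_mul]
  refine Finset.sum_congr rfl fun d _ => ?_
  rw [Finset.mul_sum]

/-- Change of variables in a trilinear form: `Σ_p (T ∘ M)_p u_{p₁} v_{p₂} w_{p₃} = Σ_q T_q (Mu)_{q₁} (Mv)_{q₂} (Mw)_{q₃}`.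
[folklore] -/
theorem sum_trilin_transform₃ {R : Type*} [CommRing R] {n : ℕ} (T : Fin n × Fin n × Fin n → R)
    (M : Matrix (Fin n) (Fin n) R) (u v w : Fin n → R) :
    ∑ p : Fin n × Fin n × Fin n,
        (∑ q : Fin n × Fin n × Fin n, T q * M q.1 p.1 * M q.2.1 p.2.1 * M q.2.2 p.2.2) *
          u p.1 * v p.2.1 * w p.2.2 =
      ∑ q : Fin n × Fin n × Fin n, T q * (M *ᵥ u) q.1 * (M *ᵥ v) q.2.1 * (M *ᵥ w) q.2.2 := by
  have hR : ∀ q : Fin n × Fin n × Fin n,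
      T q * (M *ᵥ u) q.1 * (M *ᵥ v) q.2.1 * (M *ᵥ w) q.2.2 =
        ∑ p : Fin n × Fin n × Fin n, T q * M q.1 p.1 * M q.2.1 p.2.1 * M q.2.2 p.2.2 *
          u p.1 * v p.2.1 * w p.2.2 := by
    intro q
    simp only [Matrix.mulVec, dotProduct]
    rw [mul_assoc, mul_assoc, ← mul_assoc (∑ c, M q.1 c * u c), sum_mul_sum_mul_sum_eq_sum_prod,
      Finset.mul_sum]
    refine Finset.sum_congr rfl fun p _ => ?_
    ring
  simp_rw [hR, Finset.sum_mul]
  rw [Finset.sum_comm]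

/-- Change of variables in a cubic form: `Σ_p (T ∘ M)_p v_p = Σ_q T_q (Mv)_q`. [folklore] -/
theorem sum_trilin_transform {R : Type*} [CommRing R] {n : ℕ} (T : Fin n × Fin n × Fin n → R)
    (M : Matrix (Fin n) (Fin n) R) (v : Fin n → R) :
    ∑ p : Fin n × Fin n × Fin n,
        (∑ q : Fin n × Fin n × Fin n, T q * M q.1 p.1 * M q.2.1 p.2.1 * M q.2.2 p.2.2) *
          v p.1 * v p.2.1 * v p.2.2 =
      ∑ q : Fin n × Fin n × Fin n, T q * (M *ᵥ v) q.1 * (M *ᵥ v) q.2.1 * (M *ᵥ v) q.2.2 :=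
  sum_trilin_transform₃ T M v v v

/-- `Φ* Q_B(x) = Q_{B'}(g⁻¹ x) = Q_{B'}(e₀) = B'₀₀ = 0`: the point `x` lies on the quadric.
[folklore] -/
theorem phiStar_QBx : phiStar k QBx = 0 := by
  have h1 : phiStar k QBx = ∑ i : Fin 9, ∑ j : Fin 9, phiBmat i j * xv i * xv j := by
    simp [QBx, map_sum, map_mul, phiStar_xN, phiVal]
  rw [h1, sum_sum_mul_eq_dotProduct_mulVec, phiBmat, ← Matrix.mulVec_mulVec, ← Matrix.mulVec_mulVec,
    Matrix.dotProduct_mulVec, Matrix.vecMul_transpose, ginv_mulVec_xv]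
  simp [Matrix.mulVec_single, Bmat, Bp, depB]

/-- `Φ* C_T(x) = C_{T'}(e₀) = T'₀₀₀ = 0`: the point `x` lies on the cubic. [folklore] -/
theorem phiStar_CTx : phiStar k CTx = 0 := by
  have h1 : phiStar k CTx = ∑ p : Fin 9 × Fin 9 × Fin 9, phiT p * xv p.1 * xv p.2.1 * xv p.2.2 := by
    simp [CTx, map_sum, map_mul, phiStar_xN, phiVal]
  rw [h1]
  simp only [phiT]
  rw [sum_trilin_transform, ginv_mulVec_xv]
  rw [Finset.sum_eq_single (0, 0, 0)]
  · simp [Tp, depT, depTval]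
  · rintro ⟨c, d, e⟩ - hne
    by_cases hc : c = 0
    · by_cases hd : d = 0
      · have he : e ≠ 0 := fun he => hne (by rw [hc, hd, he])
        simp [he]
      · simp [hd]
    · simp [hc]
  · intro h; exact absurd (Finset.mem_univ _) h


/-! ### Inverting the change of variables: `B' = gᵀ B g`, `T' = T ∘ g` -/

/-- `B' = gᵀ (Φ*B) g`. [folklore] -/
theorem Bmat_eq : Bmat (k := k) = gᵀ * phiBmat * g := by
  rw [phiBmat, ← Matrix.mul_assoc, ← Matrix.mul_assoc, ← Matrix.transpose_mul, Matrix.mul_assoc,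
    ginv_mul_g, Matrix.transpose_one, Matrix.one_mul, Matrix.mul_one]

/-- A column of a product: `M (N e_c) = (M N) e_c`. [folklore] -/
theorem mulVec_col {R : Type*} [CommRing R] {n : ℕ} (M N : Matrix (Fin n) (Fin n) R) (c : Fin n) :
    (M *ᵥ fun r => N r c) = fun r => (M * N) r c := by
  ext r
  simp [Matrix.mulVec, dotProduct, Matrix.mul_apply]

/-- `T' = (Φ*T) ∘ g`: `T'_{p'} = Σ_p (Φ*T)_p g_{p₁p'₁} g_{p₂p'₂} g_{p₃p'₃}`. [folklore] -/
theorem Tp_eq (p' : Fin 9 × Fin 9 × Fin 9) :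
    Tp (k := k) p' = ∑ p : Fin 9 × Fin 9 × Fin 9, phiT p * g p.1 p'.1 * g p.2.1 p'.2.1 * g p.2.2 p'.2.2 := by
  simp only [phiT]
  rw [sum_trilin_transform₃ Tp ginv (fun r => g r p'.1) (fun r => g r p'.2.1) (fun r => g r p'.2.2),
    mulVec_col, mulVec_col, mulVec_col, ginv_mul_g]
  rw [Finset.sum_eq_single p']
  · simp
  · rintro ⟨c, d, e⟩ - hne
    obtain ⟨c', d', e'⟩ := p'
    by_cases hc : c = c'
    · by_cases hd : d = d'
      · have he : e ≠ e' := fun he => hne (by rw [hc, hd, he])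
        simp [Matrix.one_apply, he]
      · simp [Matrix.one_apply, hd]
    · simp [Matrix.one_apply, hc]
  · intro h; exact absurd (Finset.mem_univ _) h

/-! ### The symmetrisation classes of the dependent entries of `T'` sum to zero -/

/-- The `s²t`-class of `T'` sums to zero. [folklore] -/
theorem Tp_class_001 : Tp (k := k) (0,0,1) + Tp (0,1,0) + Tp (1,0,0) = 0 := by
  simp [Tp, depT, depTval, tX]
/-- The `s²r`-class of `T'` sums to zero. [folklore] -/
theorem Tp_class_002 : Tp (k := k) (0,0,2) + Tp (0,2,0) + Tp (2,0,0) = 0 := by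
  simp [Tp, depT, depTval, tX]
/-- The `st²`-class of `T'` sums to zero. [folklore] -/
theorem Tp_class_011 : Tp (k := k) (0,1,1) + Tp (1,0,1) + Tp (1,1,0) = 0 := by
  simp [Tp, depT, depTval, tX]
/-- The `str`-class of `T'` sums to zero. [folklore] -/
theorem Tp_class_012 : Tp (k := k) (0,1,2) + Tp (0,2,1) + Tp (1,0,2) + Tp (1,2,0) + Tp (2,0,1) + Tp (2,1,0) = 0 := by
  simp [Tp, depT, depTval, tX]; ring
/-- The `sr²`-class of `T'` sums to zero. [folklore] -/
theorem Tp_class_022 : Tp (k := k) (0,2,2) + Tp (2,0,2) + Tp (2,2,0) = 0 := by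
  simp [Tp, depT, depTval, tX]
/-- The `t³`-entry of `T'` vanishes. [folklore] -/
theorem Tp_class_111 : Tp (k := k) (1,1,1) = 0 := by
  simp [Tp, depT, depTval]
/-- The `t²r`-class of `T'` sums to zero. [folklore] -/
theorem Tp_class_112 : Tp (k := k) (1,1,2) + Tp (1,2,1) + Tp (2,1,1) = 0 := by
  simp [Tp, depT, depTval, tX]
/-- The `tr²`-class of `T'` sums to zero. [folklore] -/
theorem Tp_class_122 : Tp (k := k) (1,2,2) + Tp (2,1,2) + Tp (2,2,1) = 0 := by
  simp [Tp, depT, depTval, tX]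


/-! ### The rigid example: `Q₀ = x₀x₃ + x₁x₄ + x₂x₅`, `C₀ = x₀²x₆ + x₀x₁x₇ + x₀x₂x₈ + x₁²x₅ + x₁x₂x₈ + x₂³ + x₁x₈²` -/

section Example

variable {K : Type*} [Field K]

/-- The bilinear form of `Q₀ = x₀x₃ + x₁x₄ + x₂x₅` (upper triangular coefficients). [folklore] -/
def B0 (cd : Fin 9 × Fin 9) : K :=
  (if cd = (0, 3) then 1 else 0) + (if cd = (1, 4) then 1 else 0) + (if cd = (2, 5) then 1 else 0)

/-- The trilinear form of `C₀` (one coefficient per monomial). [folklore] -/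
def T0 (p : Fin 9 × Fin 9 × Fin 9) : K :=
  (if p = (0, 0, 6) then 1 else 0) + (if p = (0, 1, 7) then 1 else 0) + (if p = (0, 2, 8) then 1 else 0) +
    (if p = (1, 1, 5) then 1 else 0) + (if p = (1, 2, 8) then 1 else 0) + (if p = (2, 2, 2) then 1 else 0) +
    (if p = (1, 8, 8) then 1 else 0)

/-- The point `t₀ = (B₀, T₀, x' = 0)` of `N` (the pair `(Q₀, C₀)` and the point `x₀ = e₀`).
[folklore] -/
def t0 : NVar → K
  | .x _ => 0
  | .b cd => B0 cd
  | .t p => T0 p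

/-- The point `z₀` of `𝔸⁸¹⁶` over `t₀`: the standard flag `e₀ ∈ span(e₀,e₁) ⊆ span(e₀,e₁,e₂)` and
`(B', T') = (B₀, T₀)`.
[folklore] -/
def z0 : ZVar → K
  | .x _ => 0
  | .a _ => 0
  | .y _ => 0
  | .b ij => B0 ij.1
  | .t p => T0 p.1

variable (P : Ideal (RZ K)) (hP : ∀ n : NVar, phiStar K (X n) - C (t0 n) ∈ P)

section Derivation

include hP

local notation "π" => Ideal.Quotient.mk P


/-- Modulo `P ⊇ Φ*(𝔪_{t₀})`, the values of `Φ*` are the coordinates of `t₀`. [folklore] -/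
theorem hq (n : NVar) : π (phiVal n) = π (C (t0 n)) := by
  have h := (Ideal.Quotient.eq (I := P)).2 (hP n)
  rwa [phiStar_X] at h

/-- Modulo `P`, `x' = 0`. [folklore] -/
theorem hx (i : Fin 8) : π (X (.x i) : RZ K) = 0 := by
  have h := hq P hP (.x i)
  simpa [phiVal, t0] using h

omit hP in
/-- `Σ_x (Σ_y [ (y,x) = (a,b) ] G_y) H_x = G_a H_b`. [folklore] -/
theorem sum_sum_pair_indicator {Q : Type*} [CommRing Q] (a b : Fin 9) (G H : Fin 9 → Q) :
    ∑ x : Fin 9, (∑ y : Fin 9, if (y, x) = (a, b) then G y else 0) * H x = G a * H b := by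
  have h : ∀ x : Fin 9, (∑ y : Fin 9, if (y, x) = (a, b) then G y else 0) = if x = b then G a else 0 := by
    intro x
    by_cases hxb : x = b
    · subst hxb
      rw [if_pos rfl, Finset.sum_eq_single a]
      · simp
      · intro y _ hy; simp [hy]
      · intro h; exact absurd (Finset.mem_univ _) h
    · rw [if_neg hxb]
      refine Finset.sum_eq_zero fun y _ => ?_
      simp [hxb]
  simp_rw [h]
  simp [ite_mul]

omit hP in
/-- Multiplication by the indicator coefficients of `B₀`, modulo `P`. [folklore] -/
theorem hB0G (q : Fin 9 × Fin 9) (G : RZ K ⧸ P) :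
    G * π (C (B0 q)) = (if q = (0, 3) then G else 0) + (if q = (1, 4) then G else 0) +
      (if q = (2, 5) then G else 0) := by
  have hterm : ∀ a : Fin 9 × Fin 9, G * π (C (if q = a then (1 : K) else 0)) = if q = a then G else 0 := by
    intro a; split_ifs <;> simp
  simp only [B0, map_add, mul_add, hterm]

omit hP in
/-- Multiplication by the indicator coefficients of `T₀`, modulo `P`. [folklore] -/
theorem hT0F (p : Fin 9 × Fin 9 × Fin 9) (F : RZ K ⧸ P) :
    π (C (T0 p)) * F = (if p = (0, 0, 6) then F else 0) + (if p = (0, 1, 7) then F else 0) +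
      (if p = (0, 2, 8) then F else 0) + (if p = (1, 1, 5) then F else 0) + (if p = (1, 2, 8) then F else 0) +
      (if p = (2, 2, 2) then F else 0) + (if p = (1, 8, 8) then F else 0) := by
  have hterm : ∀ a : Fin 9 × Fin 9 × Fin 9, π (C (if p = a then (1 : K) else 0)) * F = if p = a then F else 0 := by
    intro a; split_ifs <;> simp
  simp only [T0, map_add, add_mul, hterm]

/-- `π B'_{ij} = Σ_{(c,d) ∈ supp B₀} π g_{ci} π g_{dj}`. [folklore] -/
theorem piB (i j : Fin 9) :
    π (Bp i j) = π (g 0 i) * π (g 3 j) + π (g 1 i) * π (g 4 j) + π (g 2 i) * π (g 5 j) := by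
  have h := congrArg (fun M : Matrix (Fin 9) (Fin 9) (RZ K) => π (M i j)) (Bmat_eq (k := K))
  simp only [Bmat, Matrix.of_apply] at h
  rw [h]
  simp only [Matrix.mul_apply, Matrix.transpose_apply, map_sum, map_mul]
  have hb : ∀ c d : Fin 9, π (phiBmat c d) = π (C (B0 (c, d))) := fun c d => hq P hP (.b (c, d))
  simp only [hb, hB0G P, Finset.sum_add_distrib, add_mul, sum_sum_pair_indicator]

/-- `π T'_{cde} = Σ_{(c',d',e') ∈ supp T₀} π g_{c'c} π g_{d'd} π g_{e'e}`. [folklore] -/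
theorem piT (c d e : Fin 9) :
    π (Tp (c, d, e)) = π (g 0 c) * π (g 0 d) * π (g 6 e) + π (g 0 c) * π (g 1 d) * π (g 7 e) +
      π (g 0 c) * π (g 2 d) * π (g 8 e) + π (g 1 c) * π (g 1 d) * π (g 5 e) +
      π (g 1 c) * π (g 2 d) * π (g 8 e) + π (g 2 c) * π (g 2 d) * π (g 2 e) +
      π (g 1 c) * π (g 8 d) * π (g 8 e) := by
  rw [Tp_eq]
  simp only [map_sum, map_mul]
  have ht : ∀ p : Fin 9 × Fin 9 × Fin 9, π (phiT p) = π (C (T0 p)) := fun p => hq P hP (.t p)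
  simp only [mul_assoc]
  simp only [ht, hT0F P, Finset.sum_add_distrib, Finset.sum_ite_eq', Finset.mem_univ, if_true]

/-! #### The thirteen equations at `z₀` and their solution -/

/-- Equation `(1,1)` of `B' ≡ B₀ ∘ g`: `a₄ + a₂a₅ ≡ 0`. [folklore] -/
theorem eB11 : π (X (.a 2) : RZ K) + π (X (.a 0)) * π (X (.a 3)) = 0 := by
  have e := piB P hP 1 1
  simp [Bp, depB, g, frame, xv, av, yv] at e
  linear_combination -e

/-- Equation `(2,2)`: `y₅ ≡ 0`. [folklore] -/
theorem eB22 : π (X (.y 2) : RZ K) = 0 := by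
  have e := piB P hP 2 2
  simp [Bp, depB, g, frame, xv, av, yv] at e
  linear_combination -e

/-- Equations `(0,1)+(1,0)`: `a₃ ≡ 0`. [folklore] -/
theorem eB01 : π (X (.a 1) : RZ K) = 0 := by
  have e1 := piB P hP 0 1
  have e2 := piB P hP 1 0
  have e12 : π (Bp 0 1 : RZ K) + π (Bp 1 0) = 0 := by
    rw [← map_add]; simp [Bp, depB, bX]
  rw [e1, e2] at e12
  simp [g, frame, xv, av, yv, hx P hP] at e12
  linear_combination e12

/-- Equations `(0,2)+(2,0)`: `y₃ ≡ 0`. [folklore] -/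
theorem eB02 : π (X (.y 0) : RZ K) = 0 := by
  have e1 := piB P hP 0 2
  have e2 := piB P hP 2 0
  have e12 : π (Bp 0 2 : RZ K) + π (Bp 2 0) = 0 := by
    rw [← map_add]; simp [Bp, depB, bX]
  rw [e1, e2] at e12
  simp [g, frame, xv, av, yv, hx P hP] at e12
  linear_combination e12

/-- Equations `(1,2)+(2,1)`: `y₄ + a₂y₅ + a₅ ≡ 0`. [folklore] -/
theorem eB12 : π (X (.y 1) : RZ K) + π (X (.a 0)) * π (X (.y 2)) + π (X (.a 3)) = 0 := by
  have e1 := piB P hP 1 2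
  have e2 := piB P hP 2 1
  have e12 : π (Bp 1 2 : RZ K) + π (Bp 2 1) = 0 := by
    rw [← map_add]; simp [Bp, depB, bX]
  rw [e1, e2] at e12
  simp [g, frame, xv, av, yv] at e12
  linear_combination e12

/-- Class `s²t` of `T' ≡ T₀ ∘ g`: `a₆ ≡ 0`. [folklore] -/
theorem eT001 : π (X (.a 4) : RZ K) = 0 := by
  have e := congrArg π (Tp_class_001 (k := K))
  simp only [map_add, map_zero, piT P hP] at e
  simp [g, frame, xv, av, yv, hx P hP] at e
  linear_combination e

/-- Class `s²r`: `y₆ ≡ 0`. [folklore] -/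
theorem eT002 : π (X (.y 3) : RZ K) = 0 := by
  have e := congrArg π (Tp_class_002 (k := K))
  simp only [map_add, map_zero, piT P hP] at e
  simp [g, frame, xv, av, yv, hx P hP] at e
  linear_combination e

/-- Class `st²`: `a₇ + a₂a₈ ≡ 0`. [folklore] -/
theorem eT011 : π (X (.a 5) : RZ K) + π (X (.a 0)) * π (X (.a 6)) = 0 := by
  have e := congrArg π (Tp_class_011 (k := K))
  simp only [map_add, map_zero, piT P hP] at e
  simp [g, frame, xv, av, yv, hx P hP] at e
  linear_combination e

/-- Class `str`: `y₇ + a₂y₈ + a₈ ≡ 0`. [folklore] -/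
theorem eT012 : π (X (.y 4) : RZ K) + π (X (.a 0)) * π (X (.y 5)) + π (X (.a 6)) = 0 := by
  have e := congrArg π (Tp_class_012 (k := K))
  simp only [map_add, map_zero, piT P hP] at e
  simp [g, frame, xv, av, yv, hx P hP] at e
  linear_combination e

/-- Class `sr²`: `y₈ ≡ 0`. [folklore] -/
theorem eT022 : π (X (.y 5) : RZ K) = 0 := by
  have e := congrArg π (Tp_class_022 (k := K))
  simp only [map_add, map_zero, piT P hP] at e
  simp [g, frame, xv, av, yv, hx P hP] at e
  linear_combination e

/-- Class `t³`: `a₅ + a₂a₈ + a₂³ + a₈² ≡ 0`. [folklore] -/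
theorem eT111 : π (X (.a 3) : RZ K) + π (X (.a 0)) * π (X (.a 6)) + π (X (.a 0)) ^ 3 +
    π (X (.a 6)) ^ 2 = 0 := by
  have e := congrArg π (Tp_class_111 (k := K))
  simp only [map_zero, piT P hP] at e
  simp [g, frame, xv, av, yv] at e
  linear_combination e

/-- Class `t²r`: `y₅ + a₂y₈ + a₈ + 3a₂² + 2a₈y₈ ≡ 0`. [folklore] -/
theorem eT112 : π (X (.y 2) : RZ K) + π (X (.a 0)) * π (X (.y 5)) + π (X (.a 6)) +
    3 * π (X (.a 0)) ^ 2 + 2 * π (X (.a 6)) * π (X (.y 5)) = 0 := by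
  have e := congrArg π (Tp_class_112 (k := K))
  simp only [map_add, map_zero, piT P hP] at e
  simp [g, frame, xv, av, yv] at e
  linear_combination e

/-- Class `tr²`: `y₈ + 3a₂ + y₈² ≡ 0`. [folklore] -/
theorem eT122 : π (X (.y 5) : RZ K) + 3 * π (X (.a 0)) + π (X (.y 5)) ^ 2 = 0 := by
  have e := congrArg π (Tp_class_122 (k := K))
  simp only [map_add, map_zero, piT P hP] at e
  simp [g, frame, xv, av, yv] at e
  linear_combination e

variable [CharZero K]

/-- `a₂ ≡ 0` (uses `3 ≠ 0`). [folklore] -/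
theorem hA0 : π (X (.a 0) : RZ K) = 0 := by
  have hY5 := eT022 P hP
  have h3 : (3 : RZ K ⧸ P) * π (X (.a 0)) = 0 := by
    linear_combination eT122 P hP - (1 + π (X (.y 5) : RZ K)) * hY5
  have hinv : algebraMap K (RZ K ⧸ P) (3⁻¹ : K) * 3 = 1 := by
    rw [← map_ofNat (algebraMap K (RZ K ⧸ P)) 3, ← map_mul, inv_mul_cancel₀ (by norm_num), map_one]
  calc π (X (.a 0) : RZ K) = (algebraMap K (RZ K ⧸ P) (3⁻¹ : K) * 3) * π (X (.a 0)) := by rw [hinv, one_mul]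
    _ = algebraMap K (RZ K ⧸ P) (3⁻¹ : K) * (3 * π (X (.a 0))) := by ring
    _ = 0 := by rw [h3, mul_zero]

/-- **The thirteen frame coordinates vanish modulo `P`**: the triangular system has only the zero solution to all orders. [folklore] -/
theorem hA_all : (π (X (.a 0) : RZ K) = 0 ∧ π (X (.a 1) : RZ K) = 0 ∧ π (X (.a 2) : RZ K) = 0 ∧
    π (X (.a 3) : RZ K) = 0 ∧ π (X (.a 4) : RZ K) = 0 ∧ π (X (.a 5) : RZ K) = 0 ∧ π (X (.a 6) : RZ K) = 0) ∧
    (π (X (.y 0) : RZ K) = 0 ∧ π (X (.y 1) : RZ K) = 0 ∧ π (X (.y 2) : RZ K) = 0 ∧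
    π (X (.y 3) : RZ K) = 0 ∧ π (X (.y 4) : RZ K) = 0 ∧ π (X (.y 5) : RZ K) = 0) := by
  have h0 := hA0 P hP
  have hY5 := eT022 P hP
  have hY3 := eT002 P hP
  have hA4 := eT001 P hP
  have hY2 := eB22 P hP
  have hA1 := eB01 P hP
  have hY0 := eB02 P hP
  have hA5 : π (X (.a 5) : RZ K) = 0 := by
    linear_combination eT011 P hP - π (X (.a 6) : RZ K) * h0
  have hA6 : π (X (.a 6) : RZ K) = 0 := by
    linear_combination eT112 P hP - hY2 - (π (X (.y 5) : RZ K) + 3 * π (X (.a 0) : RZ K)) * h0 -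
      2 * π (X (.a 6) : RZ K) * hY5
  have hY4 : π (X (.y 4) : RZ K) = 0 := by
    linear_combination eT012 P hP - π (X (.y 5) : RZ K) * h0 - hA6
  have hA3 : π (X (.a 3) : RZ K) = 0 := by
    linear_combination eT111 P hP - (π (X (.a 6) : RZ K) + π (X (.a 0) : RZ K) ^ 2) * h0 -
      π (X (.a 6) : RZ K) * hA6
  have hY1 : π (X (.y 1) : RZ K) = 0 := by
    linear_combination eB12 P hP - π (X (.y 2) : RZ K) * h0 - hA3
  have hA2 : π (X (.a 2) : RZ K) = 0 := by
    linear_combination eB11 P hP - π (X (.a 3) : RZ K) * h0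
  exact ⟨⟨h0, hA1, hA2, hA3, hA4, hA5, hA6⟩, ⟨hY0, hY1, hY2, hY3, hY4, hY5⟩⟩

/-! #### At `z₀` the frame is the standard one, so `B' ≡ B₀`, `T' ≡ T₀` -/

/-- Modulo `P` the frame is the standard one: `g ≡ 1`. [folklore] -/
theorem hg_one (c i : Fin 9) : π (g c i) = (1 : Matrix (Fin 9) (Fin 9) (RZ K ⧸ P)) c i := by
  obtain ⟨⟨hA0', hA1, hA2, hA3, hA4, hA5, hA6⟩, ⟨hY0, hY1, hY2, hY3, hY4, hY5⟩⟩ := hA_all P hP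
  have hxq := hx P hP
  rw [Matrix.one_apply]
  fin_cases i <;> fin_cases c <;>
    simp [g, frame, xv, av, yv, hxq, hA0', hA1, hA2, hA3, hA4, hA5, hA6, hY0, hY1, hY2, hY3, hY4, hY5]

omit hP in
/-- Product of two Kronecker deltas as the indicator of a pair. [folklore] -/
theorem delta_mul_delta (Q : Type*) [CommRing Q] (a b i j : Fin 9) :
    ((if a = i then (1 : Q) else 0) * if b = j then 1 else 0) = if (i, j) = (a, b) then 1 else 0 := by
  by_cases ha : a = i <;> by_cases hb : b = j <;> simp [ha, hb, Prod.ext_iff, eq_comm]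

omit hP in
/-- Product of three Kronecker deltas as the indicator of a triple. [folklore] -/
theorem delta_mul_delta_mul_delta (Q : Type*) [CommRing Q] (a b f i j l : Fin 9) :
    ((if a = i then (1 : Q) else 0) * (if b = j then 1 else 0) * if f = l then 1 else 0) =
      if (i, j, l) = (a, b, f) then 1 else 0 := by
  by_cases ha : a = i <;> by_cases hb : b = j <;> by_cases hf : f = l <;> simp [ha, hb, hf, Prod.ext_iff, eq_comm]

/-- Modulo `P`, the free entries of `B'` are those of `B₀`. [folklore] -/
theorem hb_free (ij : FB) : π (X (.b ij) : RZ K) = π (C (B0 ij.1)) := by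
  obtain ⟨⟨i, j⟩, hij⟩ := ij
  have e := piB P hP i j
  have hBp : Bp (k := K) i j = X (.b ⟨(i, j), hij⟩) := by simp [Bp, hij]
  rw [hBp] at e
  rw [e]
  simp only [hg_one P hP, Matrix.one_apply, delta_mul_delta]
  rw [show π (C (B0 (i, j)) : RZ K) = 1 * π (C (B0 (i, j))) by ring, hB0G P]

/-- Modulo `P`, the free entries of `T'` are those of `T₀`. [folklore] -/
theorem ht_free (p : FT) : π (X (.t p) : RZ K) = π (C (T0 p.1)) := by
  obtain ⟨⟨c, d, e⟩, hp⟩ := p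
  have h := piT P hP c d e
  have hTp : Tp (k := K) (c, d, e) = X (.t ⟨(c, d, e), hp⟩) := by simp [Tp, hp]
  rw [hTp] at h
  rw [h]
  simp only [hg_one P hP, Matrix.one_apply, delta_mul_delta_mul_delta]
  rw [show π (C (T0 (c, d, e)) : RZ K) = π (C (T0 (c, d, e))) * 1 by ring, hT0F P]

/-- **The fibre of the universal family over `t₀` is the reduced point `z₀` near `z₀`**, in the
form: any ideal containing `Φ*(𝔪_{t₀})` contains `𝔪_{z₀}`.
[cite: HirschowitzIyer2010, §4 Prop. 4.1 and §6 Prop. 6.2 (proof)] -/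
theorem X_sub_C_z0_mem (v : ZVar) : X v - C (z0 v) ∈ P := by
  obtain ⟨⟨hA0', hA1, hA2, hA3, hA4, hA5, hA6⟩, ⟨hY0, hY1, hY2, hY3, hY4, hY5⟩⟩ := hA_all P hP
  rw [← Ideal.Quotient.eq]
  cases v with
  | x i => simp [z0, hx P hP]
  | a i => fin_cases i <;> simp [z0, hA0', hA1, hA2, hA3, hA4, hA5, hA6]
  | y i => fin_cases i <;> simp [z0, hY0, hY1, hY2, hY3, hY4, hY5]
  | b ij => exact hb_free P hP ij
  | t p => exact ht_free P hP p

end Derivation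


/-! ### `Φ(z₀) = t₀`: evaluation compatibility -/

section EvalCompat

local notation "ε" => MvPolynomial.eval (z0 (K := K))

omit hP in
/-- At `z₀` the frame matrix is the identity. [folklore] -/
theorem eval_z0_g (c i : Fin 9) : ε (g c i) = (1 : Matrix (Fin 9) (Fin 9) K) c i := by
  rw [Matrix.one_apply]
  fin_cases i <;> fin_cases c <;> simp [g, frame, xv, av, yv, z0]

omit hP in
/-- At `z₀`, `g = 1`. [folklore] -/
theorem map_eval_z0_g : (g (k := K)).map ε = 1 := by
  refine Matrix.ext fun c i => ?_
  rw [Matrix.map_apply, eval_z0_g]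

omit hP in
/-- At `z₀`, `g⁻¹ = 1`. [folklore] -/
theorem map_eval_z0_ginv : (ginv (k := K)).map ε = 1 := by
  have h := congrArg (fun M : Matrix (Fin 9) (Fin 9) (RZ K) => M.map ε) (g_mul_ginv (k := K))
  rw [Matrix.map_mul, map_eval_z0_g, Matrix.one_mul, Matrix.map_one _ (map_zero _) (map_one _)] at h
  exact h

omit hP in
/-- At `z₀`, `B' = B₀`. [folklore] -/
theorem eval_z0_Bp (c d : Fin 9) : ε (Bp c d) = B0 (c, d) := by
  by_cases h : (c, d) ∈ depB
  · have h' := h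
    simp only [depB, Finset.mem_insert, Finset.mem_singleton, Prod.mk.injEq] at h'
    rcases h' with ⟨rfl, rfl⟩ | ⟨rfl, rfl⟩ | ⟨rfl, rfl⟩ | ⟨rfl, rfl⟩ | ⟨rfl, rfl⟩ | ⟨rfl, rfl⟩ <;>
      simp (config := {decide := true}) [Bp, depB, bX, z0, B0]
  · simp [Bp, h, z0]

omit hP in
/-- At `z₀`, `Φ*B = B₀`. [folklore] -/
theorem eval_z0_phiBmat (c d : Fin 9) : ε (phiBmat c d) = B0 (c, d) := by
  have h : (phiBmat (k := K)).map ε = (Bmat (k := K)).map ε := by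
    rw [phiBmat, Matrix.map_mul, Matrix.map_mul, Matrix.transpose_map, map_eval_z0_ginv,
      Matrix.transpose_one, Matrix.one_mul, Matrix.mul_one]
  have h' := congrArg (fun M : Matrix (Fin 9) (Fin 9) K => M c d) h
  simp only [Matrix.map_apply] at h'
  rw [h']
  simp [Bmat, eval_z0_Bp]

omit hP in
/-- At `z₀`, `T' = T₀`. [folklore] -/
theorem eval_z0_Tp (q : Fin 9 × Fin 9 × Fin 9) : ε (Tp q) = T0 q := by
  by_cases h : q ∈ depT
  · have h' := h
    simp only [depT, Finset.mem_insert, Finset.mem_singleton] at h'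
    rcases h' with rfl | rfl | rfl | rfl | rfl | rfl | rfl | rfl | rfl <;>
      simp (config := {decide := true}) [Tp, depT, depTval, tX, z0, T0]
  · simp [Tp, h, z0]

omit hP in
/-- At `z₀`, `Φ*T = T₀`. [folklore] -/
theorem eval_z0_phiT (p : Fin 9 × Fin 9 × Fin 9) : ε (phiT p) = T0 p := by
  have hgi : ∀ i j : Fin 9, ε (ginv i j) = (1 : Matrix (Fin 9) (Fin 9) K) i j := by
    intro i j
    have h := congrArg (fun M : Matrix (Fin 9) (Fin 9) K => M i j) (map_eval_z0_ginv (K := K))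
    simpa using h
  simp only [phiT, map_sum, map_mul, eval_z0_Tp, hgi]
  rw [Finset.sum_eq_single p]
  · simp
  · rintro ⟨c, d, e⟩ - hne
    obtain ⟨c', d', e'⟩ := p
    by_cases hc : c = c'
    · by_cases hd : d = d'
      · have he : e ≠ e' := fun he => hne (by rw [hc, hd, he])
        simp [Matrix.one_apply, he]
      · simp [Matrix.one_apply, hd]
    · simp [Matrix.one_apply, hc]
  · intro h; exact absurd (Finset.mem_univ _) h

omit hP in
/-- **`Φ(z₀) = t₀`**: `eval_{z₀} ∘ Φ* = eval_{t₀}`. [folklore] -/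
theorem eval_z0_comp_phiStar :
    (MvPolynomial.eval (z0 (K := K))).comp (phiStar K).toRingHom = MvPolynomial.eval t0 := by
  refine MvPolynomial.ringHom_ext (fun c => by simp) fun n => ?_
  cases n with
  | x i => simp [phiVal, t0, z0]
  | b ij => obtain ⟨c, d⟩ := ij; simp [phiVal, t0, eval_z0_phiBmat]
  | t p => simp [phiVal, t0, eval_z0_phiT]

omit hP in
/-- `(Φ* f)(z₀) = f(t₀)`. [folklore] -/
theorem eval_z0_phiStar (f : RN K) : MvPolynomial.eval z0 (phiStar K f) = MvPolynomial.eval t0 f := by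
  have h := congrArg (fun φ : RN K →+* K => φ f) (eval_z0_comp_phiStar (K := K))
  simpa using h

end EvalCompat

/-! ### Elimination: `k[N] ⧸ (Q_B(x), C_T(x)) ≅ k[816 variables]` -/

section Elimination

/-- The coordinates of `N` other than `B₀₀` and `T₀₀₀`. [folklore] -/
abbrev NVarFree := {n : NVar // n ≠ .b (0, 0) ∧ n ≠ .t (0, 0, 0)}

/-- `x = (1, x')` in the free coordinates. [folklore] -/
def xF : Fin 9 → MvPolynomial NVarFree K :=
  ![1, X ⟨.x 0, by simp⟩, X ⟨.x 1, by simp⟩, X ⟨.x 2, by simp⟩, X ⟨.x 3, by simp⟩, X ⟨.x 4, by simp⟩,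
    X ⟨.x 5, by simp⟩, X ⟨.x 6, by simp⟩, X ⟨.x 7, by simp⟩]

/-- A `B`-coordinate in the free coordinates (`0` for `B₀₀`). [folklore] -/
def bF (ij : Fin 9 × Fin 9) : MvPolynomial NVarFree K :=
  if h : ij = (0, 0) then 0 else X ⟨.b ij, by simp [h]⟩

/-- A `T`-coordinate in the free coordinates (`0` for `T₀₀₀`). [folklore] -/
def tF (p : Fin 9 × Fin 9 × Fin 9) : MvPolynomial NVarFree K :=
  if h : p = (0, 0, 0) then 0 else X ⟨.t p, by simp [h]⟩

/-- `Q_B(x) - B₀₀` in the free coordinates. [folklore] -/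
def restB : MvPolynomial NVarFree K := ∑ i : Fin 9, ∑ j : Fin 9, bF (i, j) * xF i * xF j

/-- `C_T(x) - T₀₀₀` in the free coordinates. [folklore] -/
def restT : MvPolynomial NVarFree K := ∑ p : Fin 9 × Fin 9 × Fin 9, tF p * xF p.1 * xF p.2.1 * xF p.2.2

/-- The inclusion of the free coordinates. [folklore] -/
abbrev ι : MvPolynomial NVarFree K →ₐ[K] RN K := MvPolynomial.rename Subtype.val

omit hP P in
/-- The inclusion sends the free `x` to `x`. [folklore] -/
theorem ι_xF (i : Fin 9) : ι (xF (K := K) i) = xN i := by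
  fin_cases i <;> simp [xF, xN]

omit hP P in
/-- The inclusion on free `B`-coordinates. [folklore] -/
theorem ι_bF (ij : Fin 9 × Fin 9) (h : ij ≠ (0, 0)) : ι (bF (K := K) ij) = X (.b ij) := by
  simp [bF, h]

omit hP P in
/-- The inclusion on free `T`-coordinates. [folklore] -/
theorem ι_tF (p : Fin 9 × Fin 9 × Fin 9) (h : p ≠ (0, 0, 0)) : ι (tF (K := K) p) = X (.t p) := by
  simp [tF, h]

omit hP P in
/-- `Q_B(x) = B₀₀ + (the rest, free of B₀₀)`. [folklore] -/
theorem QBx_eq : QBx (k := K) = X (.b (0, 0)) + ι restB := by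
  have hterm : ∀ i j : Fin 9, X (.b (i, j)) * xN (k := K) i * xN j - ι (bF (i, j)) * xN i * xN j =
      if (i, j) = (0, 0) then X (.b (0, 0)) else 0 := by
    intro i j
    by_cases h : (i, j) = (0, 0)
    · simp only [Prod.mk.injEq] at h
      obtain ⟨rfl, rfl⟩ := h
      simp [bF, xN]
    · rw [if_neg h, ι_bF _ h]; ring
  have hdiff : QBx (k := K) - ι restB = X (.b (0, 0)) := by
    rw [QBx, restB, map_sum]
    simp_rw [map_sum, map_mul, ι_xF]
    rw [← Finset.sum_sub_distrib]
    simp_rw [← Finset.sum_sub_distrib, hterm]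
    rw [Finset.sum_eq_single (0 : Fin 9)]
    · rw [Finset.sum_eq_single (0 : Fin 9)]
      · simp
      · intro j _ hj; simp [hj]
      · intro h; exact absurd (Finset.mem_univ _) h
    · intro i _ hi
      exact Finset.sum_eq_zero fun j _ => by simp [hi]
    · intro h; exact absurd (Finset.mem_univ _) h
  rw [← hdiff]; ring

omit hP P in
/-- `C_T(x) = T₀₀₀ + (the rest, free of T₀₀₀)`. [folklore] -/
theorem CTx_eq : CTx (k := K) = X (.t (0, 0, 0)) + ι restT := by
  have hterm : ∀ p : Fin 9 × Fin 9 × Fin 9,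
      X (.t p) * xN (k := K) p.1 * xN p.2.1 * xN p.2.2 - ι (tF p) * xN p.1 * xN p.2.1 * xN p.2.2 =
        if p = (0, 0, 0) then X (.t (0, 0, 0)) else 0 := by
    intro p
    by_cases h : p = (0, 0, 0)
    · subst h
      simp [tF, xN]
    · rw [if_neg h, ι_tF _ h]; ring
  have hdiff : CTx (k := K) - ι restT = X (.t (0, 0, 0)) := by
    rw [CTx, restT, map_sum]
    simp_rw [map_mul, ι_xF]
    rw [← Finset.sum_sub_distrib]
    simp_rw [hterm]
    rw [Finset.sum_ite_eq']
    simp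
  rw [← hdiff]; ring

/-- The values of the elimination map `ψ`. [folklore] -/
def psiVal (n : NVar) : MvPolynomial NVarFree K :=
  if h : n ≠ .b (0, 0) ∧ n ≠ .t (0, 0, 0) then X ⟨n, h⟩
  else if n = .b (0, 0) then - restB else - restT

/-- **The elimination map** `ψ : k[N] → k[N''] `, `B₀₀ ↦ -(Q_B(x) - B₀₀)`, `T₀₀₀ ↦ -(C_T(x) - T₀₀₀)`,
identity on the other coordinates.
[folklore] -/
def ψ : RN K →ₐ[K] MvPolynomial NVarFree K := MvPolynomial.aeval psiVal

omit hP P in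
/-- `ψ ∘ ι = id`. [folklore] -/
theorem ψ_comp_ι : (ψ (K := K)).comp ι = AlgHom.id K _ := by
  refine MvPolynomial.algHom_ext fun n => ?_
  obtain ⟨n, hn⟩ := n
  simp [ψ, psiVal, hn]

omit hP P in
/-- `ψ (ι f) = f`. [folklore] -/
theorem ψ_ι (f : MvPolynomial NVarFree K) : ψ (ι f) = f := by
  have h := congrArg (fun φ : MvPolynomial NVarFree K →ₐ[K] MvPolynomial NVarFree K => φ f) (ψ_comp_ι (K := K))
  simpa using h

omit hP P in
/-- `ψ` is surjective. [folklore] -/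
theorem ψ_surjective : Function.Surjective (ψ (K := K)) := fun f => ⟨ι f, ψ_ι f⟩

omit hP P in
/-- `ψ (Q_B(x)) = 0`. [folklore] -/
theorem ψ_QBx : ψ (QBx (k := K)) = 0 := by
  rw [QBx_eq, map_add, ψ_ι]
  simp [ψ, psiVal]

omit hP P in
/-- `ψ (C_T(x)) = 0`. [folklore] -/
theorem ψ_CTx : ψ (CTx (k := K)) = 0 := by
  rw [CTx_eq, map_add, ψ_ι]
  simp (config := {decide := true}) [ψ, psiVal]

/-- The ideal `(Q_B(x), C_T(x)) ⊆ k[N]` of the incidence `{(B, T, x) : x ∈ V(Q_B) ∩ V(C_T)}`.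
[folklore] -/
def incidenceIdeal : Ideal (RN K) := Ideal.span {QBx, CTx}

omit hP P in
/-- Modulo `(Q_B(x), C_T(x))`, every polynomial is congruent to `ι (ψ f)`. [folklore] -/
theorem mk_comp_ι_comp_ψ :
    ((Ideal.Quotient.mkₐ K (incidenceIdeal (K := K))).comp ι).comp ψ = Ideal.Quotient.mkₐ K incidenceIdeal := by
  refine MvPolynomial.algHom_ext fun n => ?_
  simp only [AlgHom.coe_comp, Function.comp_apply, Ideal.Quotient.mkₐ_eq_mk]
  rw [Ideal.Quotient.eq]
  by_cases h : n ≠ .b (0, 0) ∧ n ≠ .t (0, 0, 0)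
  · simp [ψ, psiVal, h]
  · rw [not_and_or, not_not, not_not] at h
    rcases h with rfl | rfl
    · have e : ι (ψ (X (.b (0, 0)) : RN K)) - X (.b (0, 0)) = - QBx := by
        rw [QBx_eq]; simp [ψ, psiVal]; ring
      rw [e]
      exact (Ideal.neg_mem_iff _).2 (Ideal.subset_span (by simp))
    · have e : ι (ψ (X (.t (0, 0, 0)) : RN K)) - X (.t (0, 0, 0)) = - CTx := by
        rw [CTx_eq]; simp (config := {decide := true}) [ψ, psiVal]; ring
      rw [e]
      exact (Ideal.neg_mem_iff _).2 (Ideal.subset_span (by simp))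

omit hP P in
/-- **`ker ψ = (Q_B(x), C_T(x))`.** [folklore] -/
theorem ker_ψ : RingHom.ker (ψ (K := K)) = incidenceIdeal := by
  apply le_antisymm
  · intro f hf
    rw [RingHom.mem_ker] at hf
    have h := congrArg (fun φ : RN K →ₐ[K] RN K ⧸ incidenceIdeal => φ f) (mk_comp_ι_comp_ψ (K := K))
    simp only [AlgHom.coe_comp, Function.comp_apply, Ideal.Quotient.mkₐ_eq_mk] at h
    rw [show (ψ f : MvPolynomial NVarFree K) = 0 from hf, map_zero, map_zero] at h
    exact Ideal.Quotient.eq_zero_iff_mem.1 h.symm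
  · rw [incidenceIdeal, Ideal.span_le]
    rintro f (rfl | rfl)
    · exact ψ_QBx
    · exact ψ_CTx

/-- **`k[N] ⧸ (Q_B(x), C_T(x)) ≅ k[N'']`**, a polynomial ring in `816` variables. [folklore] -/
def quotIncidenceEquiv : (RN K ⧸ incidenceIdeal (K := K)) ≃ₐ[K] MvPolynomial NVarFree K :=
  (Ideal.quotientEquivAlgOfEq K (ker_ψ (K := K)).symm).trans
    (Ideal.quotientKerAlgEquivOfSurjective ψ_surjective)

end Elimination


/-! ### Dimension count: `ker Φ* = (Q_B(x), C_T(x))` -/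

section Dimension

omit hP P

/-- `|depB| = 6`. [folklore] -/
theorem depB_card : depB.card = 6 := by decide

/-- `|depT| = 9`. [folklore] -/
theorem depT_card : depT.card = 9 := by decide

/-- `𝔸⁸¹⁶` has `816` coordinates: `8 + 7 + 6 + (81 - 6) + (729 - 9)`. [folklore] -/
theorem card_ZVar : Nat.card ZVar = 816 := by
  rw [Nat.card_eq_fintype_card, ← Fintype.card_congr (proxy_equiv% ZVar)]
  simp [Fintype.card_subtype_compl, depB_card, depT_card]

/-- `N` has `818` coordinates: `8 + 81 + 729`. [folklore] -/
theorem card_NVar : Fintype.card NVar = 818 := by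
  rw [← Fintype.card_congr (proxy_equiv% NVar)]
  simp

/-- `N''` has `816` coordinates. [folklore] -/
theorem card_NVarFree : Nat.card NVarFree = 816 := by
  rw [Nat.card_eq_fintype_card,
    Fintype.card_congr (Equiv.subtypeEquivRight (p := fun n : NVar => n ≠ .b (0, 0) ∧ n ≠ .t (0, 0, 0))
      (q := fun n => n ∉ ({NVar.b (0, 0), NVar.t (0, 0, 0)} : Finset NVar)) (fun n => by simp)),
    Fintype.card_subtype_compl, Fintype.card_coe, card_NVar]
  rw [show ({NVar.b (0, 0), NVar.t (0, 0, 0)} : Finset NVar).card = 2 by decide]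

/-- `dim k[𝔸⁸¹⁶] = 816`. [folklore] -/
theorem ringKrullDim_RZ : ringKrullDim (RZ K) = (816 : ℕ) := by
  rw [MvPolynomial.ringKrullDim_of_isNoetherianRing, ringKrullDim_eq_zero_of_field, card_ZVar, zero_add]

/-- `dim k[N]/(Q_B(x), C_T(x)) = 816`. [folklore] -/
theorem ringKrullDim_quot_incidence : ringKrullDim (RN K ⧸ incidenceIdeal (K := K)) = (816 : ℕ) := by
  rw [ringKrullDim_eq_of_ringEquiv (quotIncidenceEquiv (K := K)).toRingEquiv,
    MvPolynomial.ringKrullDim_of_isNoetherianRing, ringKrullDim_eq_zero_of_field, card_NVarFree, zero_add]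

/-- `k[N]/(Q_B(x), C_T(x))` is a domain (a polynomial ring). [folklore] -/
instance isDomain_quot_incidence : IsDomain (RN K ⧸ incidenceIdeal (K := K)) :=
  MulEquiv.isDomain (MvPolynomial NVarFree K) (quotIncidenceEquiv (K := K)).toMulEquiv

/-- `(Q_B(x), C_T(x))` is prime. [folklore] -/
instance isPrime_incidenceIdeal : (incidenceIdeal (K := K)).IsPrime :=
  (Ideal.Quotient.isDomain_iff_prime _).1 inferInstance

/-- `(Q_B(x), C_T(x)) ⊆ ker Φ*`. [folklore] -/
theorem incidenceIdeal_le_ker : incidenceIdeal (K := K) ≤ RingHom.ker (phiStar K) := by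
  rw [incidenceIdeal, Ideal.span_le]
  rintro f (rfl | rfl)
  · exact phiStar_QBx
  · exact phiStar_CTx

/-- `n ≤ d` and `d + 1 ≤ n` are incompatible in `WithBot ℕ∞`. [folklore] -/
theorem withBot_enat_absurd {d : WithBot ℕ∞} {n : ℕ} (h1 : ((n : ℕ∞) : WithBot ℕ∞) ≤ d)
    (h2 : d + 1 ≤ ((n : ℕ∞) : WithBot ℕ∞)) : False := by
  induction d using WithBot.recBotCoe with
  | bot => exact absurd h1 (by simp)
  | coe d =>
    have h1' : (n : ℕ∞) ≤ d := by exact_mod_cast h1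
    have h2' : d + 1 ≤ (n : ℕ∞) := by exact_mod_cast h2
    induction d using ENat.recTopCoe with
    | top => simp at h2'
    | coe d =>
      have h1'' : n ≤ d := by exact_mod_cast h1'
      have h2'' : d + 1 ≤ n := by exact_mod_cast h2'
      omega

variable [IsAlgClosed K] [CharZero K]

/-- **The universal strong-line family dominates the incidence**: `ker Φ* = (Q_B(x), C_T(x))`.
Geometrically: the fibre of `Φ : 𝔸⁸¹⁶ → N` over `t₀` has the isolated point `z₀`, so by the
fibre-dimension inequality the closure of the image has dimension `≥ 816 = dim 𝔸⁸¹⁶`, and it is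
contained in the irreducible `816`-dimensional incidence `{Q_B(x) = C_T(x) = 0}`.
[cite: HirschowitzIyer2010, §4 Prop. 4.1 and §6 Prop. 6.2 (proof)] -/
theorem ker_phiStar_eq : RingHom.ker (phiStar K) = incidenceIdeal := by
  set 𝔭 : Ideal (RN K) := RingHom.ker (phiStar K) with h𝔭
  have hI : incidenceIdeal ≤ 𝔭 := incidenceIdeal_le_ker
  by_contra hne
  have hlt : incidenceIdeal < 𝔭 := lt_of_le_of_ne hI (Ne.symm hne)
  haveI h𝔭prime : 𝔭.IsPrime := RingHom.ker_isPrime _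
  -- (1) `dim k[N]/𝔭 + 1 ≤ 816`
  have h1 : ringKrullDim (RN K ⧸ 𝔭) + 1 ≤ ((816 : ℕ) : WithBot ℕ∞) := by
    set 𝔭' : Ideal (RN K ⧸ incidenceIdeal (K := K)) := 𝔭.map (Ideal.Quotient.mk incidenceIdeal) with h𝔭'
    have hne' : 𝔭' ≠ ⊥ := by
      intro hbot
      rw [h𝔭', Ideal.map_eq_bot_iff_le_ker, Ideal.mk_ker] at hbot
      exact absurd (le_antisymm hbot hI) (ne_of_gt hlt)
    have h := Literature.RingTheory.KrullDimension.ringKrullDim_quotient_add_one_le hne'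
    rw [ringKrullDim_quot_incidence] at h
    rwa [ringKrullDim_eq_of_ringEquiv (DoubleQuot.quotQuotEquivQuotOfLE hI)] at h
  -- (2) `816 ≤ dim k[N]/𝔭`, by the fibre inequality at the isolated point `z₀` over `t₀`
  have h2 : (((816 : ℕ) : ℕ∞) : WithBot ℕ∞) ≤ ringKrullDim (RN K ⧸ 𝔭) := by
    let φ : (RN K ⧸ 𝔭) →ₐ[K] RZ K := Ideal.Quotient.liftₐ 𝔭 (phiStar K) (fun a ha => ha)
    have hφmk : ∀ f : RN K, φ (Ideal.Quotient.mk 𝔭 f) = phiStar K f := fun f => rfl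
    -- the point `t₀` and its maximal ideal
    let m₀ : Ideal (RN K) := MvPolynomial.vanishingIdeal K {(t0 : NVar → K)}
    haveI hm₀ : m₀.IsMaximal := inferInstance
    have h𝔭m₀ : 𝔭 ≤ m₀ := by
      intro f hf
      rw [MvPolynomial.mem_vanishingIdeal_singleton_iff]
      change MvPolynomial.eval t0 f = 0
      rw [← eval_z0_phiStar]
      rw [RingHom.mem_ker] at hf
      rw [hf, map_zero]
    let m : Ideal (RN K ⧸ 𝔭) := m₀.map (Ideal.Quotient.mk 𝔭)
    haveI hm : m.IsMaximal := by
      rcases Ideal.map_eq_top_or_isMaximal_of_surjective (Ideal.Quotient.mk 𝔭) Ideal.Quotient.mk_surjective hm₀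
        with htop | hmax
      · exfalso
        have hc := congrArg (Ideal.comap (Ideal.Quotient.mk 𝔭)) htop
        rw [Ideal.comap_map_of_surjective _ Ideal.Quotient.mk_surjective, Ideal.comap_top] at hc
        have hker : Ideal.comap (Ideal.Quotient.mk 𝔭) ⊥ = 𝔭 := by
          rw [← RingHom.ker_eq_comap_bot, Ideal.mk_ker]
        rw [hker, sup_eq_left.2 h𝔭m₀] at hc
        exact hm₀.ne_top hc
      · exact hmax
    -- the point `z₀` and its maximal ideal
    let n₀ : Ideal (RZ K) := MvPolynomial.vanishingIdeal K {(z0 : ZVar → K)}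
    haveI hn₀ : n₀.IsMaximal := inferInstance
    have hcomp : (φ : (RN K ⧸ 𝔭) →+* RZ K).comp (Ideal.Quotient.mk 𝔭) = (phiStar K : RN K →+* RZ K) := by
      refine RingHom.ext fun f => ?_
      simp [hφmk]
    have hmapmap : Ideal.map φ m = Ideal.map (phiStar K : RN K →+* RZ K) m₀ := by
      rw [← hcomp, ← Ideal.map_map]
      rfl
    have hmφ : m.map φ ≤ n₀ := by
      rw [hmapmap, Ideal.map_le_iff_le_comap]
      intro f hf
      rw [Ideal.mem_comap, MvPolynomial.mem_vanishingIdeal_singleton_iff]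
      change MvPolynomial.eval z0 (phiStar K f) = 0
      rw [eval_z0_phiStar]
      exact (MvPolynomial.mem_vanishingIdeal_singleton_iff _ _).1 hf
    obtain ⟨P, hPmin, hPle⟩ := Ideal.exists_minimalPrimes_le hmφ
    haveI hPprime : P.IsPrime := hPmin.1.1
    have hPge : m.map φ ≤ P := hPmin.1.2
    -- Stage 2: `n₀ ≤ P`
    have hgen : ∀ n : NVar, phiStar K (X n) - C (t0 n) ∈ P := by
      intro n
      have hmem : X n - C (t0 n) ∈ m₀ := by
        rw [MvPolynomial.mem_vanishingIdeal_singleton_iff]; simp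
      have h1 : phiStar K (X n - C (t0 n)) ∈ m.map φ := by
        rw [hmapmap]
        exact Ideal.mem_map_of_mem _ hmem
      have h2 : phiStar K (X n - C (t0 n)) = phiStar K (X n) - C (t0 n) := by
        rw [map_sub]; congr 1; exact (phiStar K).commutes (t0 n)
      rw [← h2]
      exact hPge h1
    have hn₀P : n₀ ≤ P := by
      rw [show n₀ = _ from Literature.RingTheory.KrullDimension.vanishingIdeal_singleton_eq_span (z0 (K := K)),
        Ideal.span_le]
      rintro _ ⟨v, rfl⟩
      exact X_sub_C_z0_mem P hgen v
    have hPeq : P = n₀ := le_antisymm hPle hn₀P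
    have hdim0 : ringKrullDim (RZ K ⧸ P) = 0 := by
      rw [hPeq]
      exact ringKrullDim_eq_zero_of_isField ((Ideal.Quotient.maximal_ideal_iff_isField_quotient n₀).1 hn₀)
    have hfib := Literature.RingTheory.KrullDimension.ringKrullDim_le_ringKrullDim_quotient_add K φ m P hPmin
    rw [hdim0, zero_add, ringKrullDim_RZ] at hfib
    exact_mod_cast hfib
  exact withBot_enat_absurd h2 h1

/-- **Every point of the incidence is dominated**: a `K`-point `(B, T, x')` with
`Q_B(1, x') = C_T(1, x') = 0` kills `ker Φ*`, i.e. lies in the closure of the image of `Φ`.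
[cite: HirschowitzIyer2010, §4 Prop. 4.1 and §6 Prop. 6.2 (proof)] -/
theorem eval_eq_zero_of_mem_ker {t : NVar → K} (hQ : MvPolynomial.eval t QBx = 0)
    (hC : MvPolynomial.eval t CTx = 0) {f : RN K} (hf : f ∈ RingHom.ker (phiStar K)) :
    MvPolynomial.eval t f = 0 := by
  rw [ker_phiStar_eq, incidenceIdeal] at hf
  refine Submodule.span_induction (p := fun f _ => MvPolynomial.eval t f = 0) ?_ (by simp) ?_ ?_ hf
  · rintro g (rfl | rfl)
    · exact hQ
    · exact hC
  · intro a b _ _ ha hb; rw [map_add, ha, hb, add_zero]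
  · intro c a _ ha; rw [smul_eq_mul, map_mul, ha, mul_zero]

end Dimension
end Example
end StrongLineCover

end Literature.AlgebraicGeometry.Motives

end
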